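import Summits.CriticalPhenomena.CardyFormulaZ2.Theorems.CardyIKTransportIKMixedBoxCrossingXorStubIncr

/-!
# Helper `indepFun_row_twist` (row-twist independence) for the line `defect-closure-exploration`
# (crux `IKMixedBoxCrossing`, stmt-CriticalPhenomena-5911)

Support file (`--supports stmt-CriticalPhenomena-5911`): the EXACT structure of conditioning the gauge colour
field on a straight row. Write `ω = (A, B, Pb, Pf, C)` (column signs, row signs, biased / fair plaquettes, coins)
and let the axis be the cell row `y = 0`. For every column pattern `S`, under the gauge law `μIK`:

* the axis colours `x ↦ 𝟙[(x, 0) black]` are independent of the pair (colour TWISTS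
  `v ↦ 𝟙[v black] ⊕ 𝟙[(v 0, 0) black]` of all the other rows, coins);
* the twists of the upper rows (`v 1 > 0`) are independent of the twists of the lower rows (`v 1 < 0`).

Proof (elementary, uniform in `S`; the row version of `indepFun_left_hIncr`).
* AXIS: the anchoring rectangle of an axis cell is empty, so `(x, 0)` is black iff `A x ⊕ B 0`
  (`mem_blackSet_row0`).
* TWIST: the column sign `A (v 0)` cancels, so the twist at `v` is `(B (v 1) ⊕ B 0) ⊕` (parity of the
  plaquettes of the anchoring rectangle of `v`) (`xor_twist`); for `v 1 > 0` (resp. `< 0`) that rectangle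
  consists of faces `f` with `f 1 ≥ 0` (resp. `f 1 < 0`).
* The only shared bit is `B 0`. SHEAR: the map `B ↦ B ∆ {y ≠ 0}` if `0 ∈ B`, `B ↦ B` otherwise, preserves
  the fair sign law (`IKQuarterTurn.measurePreserving_piecewise` with `crsw_sitePercolation_half_map_symmDiff`),
  fixes the AXIS, and turns the twist at `v` (`v 1 ≠ 0`) into `B' (v 1) ⊕` (rectangle parity)
  (`xor_twist_shear`): no `B 0` any more.
* After the shear the maps read DISJOINT coordinate sets of the five independent Bernoulli fields, hence are
  independent (`IndepRestrict.indepFun_inter_of_disjoint`, `indepFun_prod_pair`, `indepFun_proj`); transfer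
  back along the measure-preserving shear (`IndepRestrict.indepFun_map_of_comp`).
-/

noncomputable section

namespace Summit.CriticalPhenomena.CardyFormulaZ2.Cruxes.IKMixedBoxCrossing.DefectClosureExploration

open scoped Classical symmDiff
open MeasureTheory ProbabilityTheory Set
open Literature.Probability.Percolation Literature.Probability.LatticeModels
open Summit.CriticalPhenomena.CardyFormulaZ2.Theorems.IKLinearTransport.PinnedDiagramExchange (Ω μIK blackSet parSet
  crsw_measurable_symmDiff_right crsw_sitePercolation_half_map_symmDiff crsw_mem_blackSet_colFlip)
open Summit.CriticalPhenomena.CardyFormulaZ2.Theorems.IKLinearTransport.PinnedDiagramExchange.CouplingToLimits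
  (measurable_xor measurable_mem_blackSet measurable_mem_parSet measurable_card_filter)
open Summit.CriticalPhenomena.CardyFormulaZ2.Theorems.IKQuarterTurn (measurePreserving_piecewise mem_Ico_min_max)
open Summit.CriticalPhenomena.CardyFormulaZ2.Cruxes.IKMixedBoxCrossing.PairedMirrorExploration.IndepRestrict
  (indepFun_map_of_comp indepFun_inter_of_disjoint indepFun_prod_pair)
open Summit.CriticalPhenomena.CardyFormulaZ2.Cruxes.IKMixedBoxCrossing.PairedMirrorExploration.MirrorRP
  renaming measurable_inter_const → mInter
open Summit.CriticalPhenomena.CardyFormulaZ2.Cruxes.IKMixedBoxCrossing.XorRectangleFlip.IncrStub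
  (mem_parSet_congr xor_shear_aux)

namespace RowTwistStub

/-! ## §1 The shear of the row signs -/

/-- The row-sign shear (`B ↦ B ∆ {y ≠ 0}` if `0 ∈ B`, `B ↦ B` otherwise) preserves the fair sign law. -/
theorem measurePreserving_shear :
    MeasurePreserving (fun B : Set ℤ => {y : ℤ | Xor (y ∈ B) ((0 : ℤ) ∈ B ∧ y ≠ 0)})
      (sitePercolation ℤ half) (sitePercolation ℤ half) := by
  have hE : MeasurableSet {B : Set ℤ | (0 : ℤ) ∈ B} := measurableSet_setOf.2 (measurable_set_mem 0)
  have hκ : MeasurePreserving (fun B : Set ℤ => B ∆ {y : ℤ | y ≠ 0}) (sitePercolation ℤ half)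
      (sitePercolation ℤ half) :=
    ⟨crsw_measurable_symmDiff_right _, crsw_sitePercolation_half_map_symmDiff _⟩
  have hinv : (fun B : Set ℤ => B ∆ {y : ℤ | y ≠ 0}) ⁻¹' {B : Set ℤ | (0 : ℤ) ∈ B} = {B | (0 : ℤ) ∈ B} := by
    ext B
    simp only [Set.mem_preimage, Set.mem_setOf_eq, Set.mem_symmDiff, ne_eq, not_true_eq_false,
      not_false_eq_true, and_true, false_and, or_false]
  have h := measurePreserving_piecewise hκ hE hinv
  have hfun : (fun B : Set ℤ => {y : ℤ | Xor (y ∈ B) ((0 : ℤ) ∈ B ∧ y ≠ 0)}) =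
      {B : Set ℤ | (0 : ℤ) ∈ B}.piecewise (fun B : Set ℤ => B ∆ {y : ℤ | y ≠ 0}) id := by
    funext B
    by_cases hB : (0 : ℤ) ∈ B
    · rw [Set.piecewise_eq_of_mem _ _ _ (show B ∈ {B' : Set ℤ | (0 : ℤ) ∈ B'} from hB)]
      ext y
      simp only [Set.mem_setOf_eq, Set.mem_symmDiff, hB, true_and, xor_def]
    · rw [Set.piecewise_eq_of_notMem _ _ _ (show B ∉ {B' : Set ℤ | (0 : ℤ) ∈ B'} from hB)]
      ext y
      simp only [Set.mem_setOf_eq, id_eq, hB, false_and, xor_def, not_false_eq_true, and_true, or_false]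
  rw [hfun]
  exact h

/-- The shear acting on the row-sign coordinate preserves `μIK`. -/
theorem measurePreserving_shearΩ :
    MeasurePreserving (fun ω : Ω => ((ω.1, ({y : ℤ | Xor (y ∈ ω.2.1) ((0 : ℤ) ∈ ω.2.1 ∧ y ≠ 0)}, ω.2.2)) : Ω))
      μIK μIK := by
  unfold μIK
  exact (MeasurePreserving.id _).prod (measurePreserving_shear.prod (MeasurePreserving.id _))

/-- The sheared row signs are the old ones flipped on `{y | 0 ∈ B ∧ y ≠ 0}`. -/
theorem shear_eq_symmDiff (B : Set ℤ) :
    {y : ℤ | Xor (y ∈ B) ((0 : ℤ) ∈ B ∧ y ≠ 0)} = B ∆ {y : ℤ | (0 : ℤ) ∈ B ∧ y ≠ 0} := by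
  ext y
  simp only [Set.mem_setOf_eq, Set.mem_symmDiff, xor_def]

/-- Colours after the shear: the cell `v` is toggled iff `0 ∈ B ∧ v 1 ≠ 0`. -/
theorem mem_blackSet_shear (S : Set ℤ) (ω : Ω) (v : Site 2) :
    v ∈ blackSet S ((ω.1, ({y : ℤ | Xor (y ∈ ω.2.1) ((0 : ℤ) ∈ ω.2.1 ∧ y ≠ 0)}, ω.2.2)) : Ω) ↔
      Xor (v ∈ blackSet S ω) ((0 : ℤ) ∈ ω.2.1 ∧ v 1 ≠ 0) := by
  rw [shear_eq_symmDiff]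
  exact crsw_mem_blackSet_colFlip S _ ω v

/-! ## §2 The axis colours and the twists -/

/-- Exclusive-or with a false proposition. -/
theorem xor_iff_left_of_not {a r : Prop} (hr : ¬ r) : (Xor a r ↔ a) := by
  grind

/-- Exclusive-or with `False` on the right. -/
theorem xor_false_right (a : Prop) : (Xor a False ↔ a) :=
  xor_iff_left_of_not not_false

/-- AXIS: the anchoring rectangle of an axis cell is empty, so `(x, 0)` is black iff `A x ⊕ B 0`. -/
theorem mem_blackSet_row0 (S : Set ℤ) (ω : Ω) (x : ℤ) :
    (![x, 0] : Site 2) ∈ blackSet S ω ↔ Xor (x ∈ ω.1) ((0 : ℤ) ∈ ω.2.1) := by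
  simp [blackSet, xor_false_right]

/-- Exclusive-or bookkeeping for the twist (the column sign `a` cancels). -/
theorem xor_twist_aux (a b b₀ p : Prop) : (Xor (Xor a (Xor b p)) (Xor a b₀) ↔ Xor (Xor b b₀) p) := by
  grind

/-- THE TWIST: `𝟙[v black] ⊕ 𝟙[(v 0, 0) black] = (B (v 1) ⊕ B 0) ⊕` (parity of the plaquettes of the
anchoring rectangle of `v`); the column sign cancels. -/
theorem xor_twist (S : Set ℤ) (ω : Ω) (v : Site 2) :
    (Xor (v ∈ blackSet S ω) ((![v 0, 0] : Site 2) ∈ blackSet S ω) ↔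
      Xor (Xor (v 1 ∈ ω.2.1) ((0 : ℤ) ∈ ω.2.1))
        (Odd ((Finset.Ico (min 0 (v 0)) (max 0 (v 0)) ×ˢ Finset.Ico (min 0 (v 1)) (max 0 (v 1))).filter
          (fun f : ℤ × ℤ => (![f.1, f.2] : Site 2) ∈ parSet S ω)).card)) := by
  rw [mem_blackSet_row0]
  simp only [blackSet, Set.mem_setOf_eq]
  exact xor_twist_aux _ _ _ _

/-- Exclusive-or bookkeeping for the sheared twist (`B 0` cancels). -/
theorem xor_twist_shear_aux {b b₀ p q r : Prop} (hq : (q ↔ b₀)) (hr : ¬ r) :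
    (Xor (Xor (Xor b b₀) p) (Xor q r) ↔ Xor b p) := by
  grind

/-- THE SHEARED TWIST: after the shear, the twist at `v` (`v 1 ≠ 0`) reads `B (v 1) ⊕` (rectangle parity). -/
theorem xor_twist_shear (S : Set ℤ) (ω : Ω) (v : Site 2) (hv : v 1 ≠ 0) :
    (Xor (v ∈ blackSet S ((ω.1, ({y : ℤ | Xor (y ∈ ω.2.1) ((0 : ℤ) ∈ ω.2.1 ∧ y ≠ 0)}, ω.2.2)) : Ω))
        ((![v 0, 0] : Site 2) ∈
          blackSet S ((ω.1, ({y : ℤ | Xor (y ∈ ω.2.1) ((0 : ℤ) ∈ ω.2.1 ∧ y ≠ 0)}, ω.2.2)) : Ω)) ↔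
      Xor (v 1 ∈ ω.2.1)
        (Odd ((Finset.Ico (min 0 (v 0)) (max 0 (v 0)) ×ˢ Finset.Ico (min 0 (v 1)) (max 0 (v 1))).filter
          (fun f : ℤ × ℤ => (![f.1, f.2] : Site 2) ∈ parSet S ω)).card)) := by
  rw [mem_blackSet_shear, mem_blackSet_shear, xor_shear_aux, xor_twist]
  exact xor_twist_shear_aux ⟨fun h => h.1, fun h => ⟨h, hv⟩⟩ fun h => h.2 rfl

/-! ## §3 What the maps read -/

/-- The AXIS is unchanged by the shear. -/
theorem axis_shear (S : Set ℤ) (ω : Ω) :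
    (fun ω : Ω => {x : ℤ | (![x, 0] : Site 2) ∈ blackSet S ω})
        ((ω.1, ({y : ℤ | Xor (y ∈ ω.2.1) ((0 : ℤ) ∈ ω.2.1 ∧ y ≠ 0)}, ω.2.2)) : Ω) =
      {x : ℤ | (![x, 0] : Site 2) ∈ blackSet S ω} := by
  ext x
  simp only [Set.mem_setOf_eq]
  rw [mem_blackSet_shear]
  exact xor_iff_left_of_not fun h => h.2 rfl

/-- The AXIS reads only `A` and `B 0`. -/
theorem axis_proj (S : Set ℤ) (P Q C : Set (Site 2)) (ω : Ω) :
    (fun ω : Ω => {x : ℤ | (![x, 0] : Site 2) ∈ blackSet S ω})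
        ((ω.1 ∩ Set.univ, (ω.2.1 ∩ {y : ℤ | y = 0}, (ω.2.2.1 ∩ P, (ω.2.2.2.1 ∩ Q, ω.2.2.2.2 ∩ C)))) : Ω) =
      {x : ℤ | (![x, 0] : Site 2) ∈ blackSet S ω} := by
  ext x
  simp only [Set.mem_setOf_eq, mem_blackSet_row0]
  have hA : (x ∈ ω.1 ∩ Set.univ ↔ x ∈ ω.1) := ⟨fun h => h.1, fun h => ⟨h, trivial⟩⟩
  have hB : ((0 : ℤ) ∈ ω.2.1 ∩ {y : ℤ | y = 0} ↔ (0 : ℤ) ∈ ω.2.1) := ⟨fun h => h.1, fun h => ⟨h, rfl⟩⟩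
  rw [hA, hB]

/-- The TWIST map on the rows selected by `p ∌ 0`, after the shear, is the sheared twist map. -/
theorem twist_shear (S : Set ℤ) (p : ℤ → Prop) (hp : ¬ p 0) (ω : Ω) :
    (fun ω : Ω => {v : Site 2 | p (v 1) ∧ Xor (v ∈ blackSet S ω) ((![v 0, 0] : Site 2) ∈ blackSet S ω)})
        ((ω.1, ({y : ℤ | Xor (y ∈ ω.2.1) ((0 : ℤ) ∈ ω.2.1 ∧ y ≠ 0)}, ω.2.2)) : Ω) =
      {v : Site 2 | p (v 1) ∧ Xor (v 1 ∈ ω.2.1)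
        (Odd ((Finset.Ico (min 0 (v 0)) (max 0 (v 0)) ×ˢ Finset.Ico (min 0 (v 1)) (max 0 (v 1))).filter
          (fun f : ℤ × ℤ => (![f.1, f.2] : Site 2) ∈ parSet S ω)).card)} := by
  ext v
  simp only [Set.mem_setOf_eq]
  exact and_congr_right fun hv => xor_twist_shear S ω v fun h0 => hp (h0 ▸ hv)

/-- The (TWISTS off the axis, coins) map after the shear. -/
theorem pair_shear (S : Set ℤ) (ω : Ω) :
    (fun ω : Ω => ({v : Site 2 | v 1 ≠ 0 ∧ Xor (v ∈ blackSet S ω) ((![v 0, 0] : Site 2) ∈ blackSet S ω)},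
        ω.2.2.2.2)) ((ω.1, ({y : ℤ | Xor (y ∈ ω.2.1) ((0 : ℤ) ∈ ω.2.1 ∧ y ≠ 0)}, ω.2.2)) : Ω) =
      ({v : Site 2 | v 1 ≠ 0 ∧ Xor (v 1 ∈ ω.2.1)
        (Odd ((Finset.Ico (min 0 (v 0)) (max 0 (v 0)) ×ˢ Finset.Ico (min 0 (v 1)) (max 0 (v 1))).filter
          (fun f : ℤ × ℤ => (![f.1, f.2] : Site 2) ∈ parSet S ω)).card)}, ω.2.2.2.2) :=
  Prod.ext (twist_shear S (fun y => y ≠ 0) (fun h => h rfl) ω) rfl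

/-- The sheared TWISTS on the rows selected by `p` read only `B` on `p` and the plaquettes of any set of
faces `F` containing their anchoring rectangles. -/
theorem twistShear_congr (S : Set ℤ) (p : ℤ → Prop) (F : Set (Site 2))
    (hF : ∀ j : ℤ, p j → ∀ f : ℤ × ℤ, f.2 ∈ Finset.Ico (min 0 j) (max 0 j) → (![f.1, f.2] : Site 2) ∈ F)
    {ω ω' : Ω} (hB : ∀ y : ℤ, p y → (y ∈ ω'.2.1 ↔ y ∈ ω.2.1))
    (hP : ∀ f ∈ F, (f ∈ parSet S ω' ↔ f ∈ parSet S ω)) :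
    {v : Site 2 | p (v 1) ∧ Xor (v 1 ∈ ω'.2.1)
        (Odd ((Finset.Ico (min 0 (v 0)) (max 0 (v 0)) ×ˢ Finset.Ico (min 0 (v 1)) (max 0 (v 1))).filter
          (fun f : ℤ × ℤ => (![f.1, f.2] : Site 2) ∈ parSet S ω')).card)} =
      {v : Site 2 | p (v 1) ∧ Xor (v 1 ∈ ω.2.1)
        (Odd ((Finset.Ico (min 0 (v 0)) (max 0 (v 0)) ×ˢ Finset.Ico (min 0 (v 1)) (max 0 (v 1))).filter
          (fun f : ℤ × ℤ => (![f.1, f.2] : Site 2) ∈ parSet S ω)).card)} := by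
  ext v
  simp only [Set.mem_setOf_eq]
  refine and_congr_right fun hv => ?_
  rw [hB _ hv, Finset.filter_congr (fun f hf => hP _ (hF _ hv f (Finset.mem_product.1 hf).2))]

/-- The sheared TWISTS after restriction to their coordinates. -/
theorem twistShear_proj (S : Set ℤ) (p : ℤ → Prop) (F : Set (Site 2))
    (hF : ∀ j : ℤ, p j → ∀ f : ℤ × ℤ, f.2 ∈ Finset.Ico (min 0 j) (max 0 j) → (![f.1, f.2] : Site 2) ∈ F)
    (C : Set (Site 2)) (A' : Set ℤ) (ω : Ω) :
    {v : Site 2 | p (v 1) ∧ Xor (v 1 ∈ ((ω.1 ∩ A', (ω.2.1 ∩ {y : ℤ | p y}, (ω.2.2.1 ∩ F, (ω.2.2.2.1 ∩ F,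
        ω.2.2.2.2 ∩ C)))) : Ω).2.1)
        (Odd ((Finset.Ico (min 0 (v 0)) (max 0 (v 0)) ×ˢ Finset.Ico (min 0 (v 1)) (max 0 (v 1))).filter
          (fun f : ℤ × ℤ => (![f.1, f.2] : Site 2) ∈ parSet S ((ω.1 ∩ A', (ω.2.1 ∩ {y : ℤ | p y},
            (ω.2.2.1 ∩ F, (ω.2.2.2.1 ∩ F, ω.2.2.2.2 ∩ C)))) : Ω))).card)} =
      {v : Site 2 | p (v 1) ∧ Xor (v 1 ∈ ω.2.1)
        (Odd ((Finset.Ico (min 0 (v 0)) (max 0 (v 0)) ×ˢ Finset.Ico (min 0 (v 1)) (max 0 (v 1))).filter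
          (fun f : ℤ × ℤ => (![f.1, f.2] : Site 2) ∈ parSet S ω)).card)} :=
  twistShear_congr S p F hF (fun _ hy => ⟨fun h => h.1, fun h => ⟨h, hy⟩⟩)
    fun _ hf => mem_parSet_congr S ⟨fun h => h.1, fun h => ⟨h, hf⟩⟩ ⟨fun h => h.1, fun h => ⟨h, hf⟩⟩

/-- The anchoring rectangles of the upper rows consist of upper faces. -/
theorem faces_upper : ∀ j : ℤ, 0 < j → ∀ f : ℤ × ℤ, f.2 ∈ Finset.Ico (min 0 j) (max 0 j) →
    (![f.1, f.2] : Site 2) ∈ {g : Site 2 | 0 ≤ g 1} := by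
  intro j hj f hf
  rw [mem_Ico_min_max] at hf
  show (0 : ℤ) ≤ f.2
  omega

/-- The anchoring rectangles of the lower rows consist of lower faces. -/
theorem faces_lower : ∀ j : ℤ, j < 0 → ∀ f : ℤ × ℤ, f.2 ∈ Finset.Ico (min 0 j) (max 0 j) →
    (![f.1, f.2] : Site 2) ∈ {g : Site 2 | g 1 < 0} := by
  intro j hj f hf
  rw [mem_Ico_min_max] at hf
  show f.2 < 0
  omega

/-! ## §4 Measurability -/

/-- The AXIS map is measurable. -/
theorem measurable_axis (S : Set ℤ) : Measurable fun ω : Ω => {x : ℤ | (![x, 0] : Site 2) ∈ blackSet S ω} :=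
  measurable_set_iff.2 fun x => measurable_mem_blackSet S ![x, 0]

/-- The TWIST maps are measurable. -/
theorem measurable_twist (S : Set ℤ) (p : ℤ → Prop) : Measurable fun ω : Ω =>
    {v : Site 2 | p (v 1) ∧ Xor (v ∈ blackSet S ω) ((![v 0, 0] : Site 2) ∈ blackSet S ω)} :=
  measurable_set_iff.2 fun v =>
    measurable_const.and (measurable_xor (measurable_mem_blackSet S v) (measurable_mem_blackSet S _))

/-- The (TWISTS off the axis, coins) map is measurable. -/
theorem measurable_pair (S : Set ℤ) : Measurable fun ω : Ω =>
    ({v : Site 2 | v 1 ≠ 0 ∧ Xor (v ∈ blackSet S ω) ((![v 0, 0] : Site 2) ∈ blackSet S ω)}, ω.2.2.2.2) :=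
  (measurable_twist S fun y => y ≠ 0).prodMk measurable_snd.snd.snd.snd

/-- The sheared TWIST maps are measurable. -/
theorem measurable_twistShear (S : Set ℤ) (p : ℤ → Prop) : Measurable fun ω : Ω =>
    {v : Site 2 | p (v 1) ∧ Xor (v 1 ∈ ω.2.1)
      (Odd ((Finset.Ico (min 0 (v 0)) (max 0 (v 0)) ×ˢ Finset.Ico (min 0 (v 1)) (max 0 (v 1))).filter
        (fun f : ℤ × ℤ => (![f.1, f.2] : Site 2) ∈ parSet S ω)).card)} := by
  refine measurable_set_iff.2 fun v => measurable_const.and (measurable_xor ?_ ?_)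
  · exact (measurable_set_mem (v 1)).comp (measurable_fst.comp measurable_snd)
  · exact (measurable_of_countable fun n : ℕ => Odd n).comp
      (measurable_card_filter _ fun f => measurable_mem_parSet S _)

/-! ## §5 Independence -/

/-- Disjoint coordinate restrictions of the five gauge fields are independent under `μIK`. -/
theorem indepFun_proj {A₁ A₂ B₁ B₂ : Set ℤ} {P₁ P₂ Q₁ Q₂ C₁ C₂ : Set (Site 2)} (dA : Disjoint A₁ A₂)
    (dB : Disjoint B₁ B₂) (dP : Disjoint P₁ P₂) (dQ : Disjoint Q₁ Q₂) (dC : Disjoint C₁ C₂) :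
    IndepFun (fun ω : Ω => ((ω.1 ∩ A₁, (ω.2.1 ∩ B₁, (ω.2.2.1 ∩ P₁, (ω.2.2.2.1 ∩ Q₁, ω.2.2.2.2 ∩ C₁)))) : Ω))
      (fun ω : Ω => ((ω.1 ∩ A₂, (ω.2.1 ∩ B₂, (ω.2.2.1 ∩ P₂, (ω.2.2.2.1 ∩ Q₂, ω.2.2.2.2 ∩ C₂)))) : Ω)) μIK := by
  have h45 := indepFun_prod_pair (mInter Q₁) (mInter Q₂) (mInter C₁) (mInter C₂)
    (indepFun_inter_of_disjoint half dQ) (indepFun_inter_of_disjoint half dC)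
  have h345 := indepFun_prod_pair (mInter P₁) (mInter P₂)
    (((mInter Q₁).comp measurable_fst).prodMk ((mInter C₁).comp measurable_snd) :
      Measurable fun x : Set (Site 2) × Set (Site 2) => (x.1 ∩ Q₁, x.2 ∩ C₁))
    (((mInter Q₂).comp measurable_fst).prodMk ((mInter C₂).comp measurable_snd) :
      Measurable fun x : Set (Site 2) × Set (Site 2) => (x.1 ∩ Q₂, x.2 ∩ C₂))
    (indepFun_inter_of_disjoint (Set.projIcc (0:ℝ) 1 zero_le_one (2 * Real.sqrt 3 - 3)) dP) h45
  have h2345 := indepFun_prod_pair (mInter B₁) (mInter B₂)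
    (((mInter P₁).comp measurable_fst).prodMk
      ((((mInter Q₁).comp measurable_fst).prodMk ((mInter C₁).comp measurable_snd)).comp measurable_snd) :
      Measurable fun x : Set (Site 2) × (Set (Site 2) × Set (Site 2)) =>
        (x.1 ∩ P₁, (x.2.1 ∩ Q₁, x.2.2 ∩ C₁)))
    (((mInter P₂).comp measurable_fst).prodMk
      ((((mInter Q₂).comp measurable_fst).prodMk ((mInter C₂).comp measurable_snd)).comp measurable_snd) :
      Measurable fun x : Set (Site 2) × (Set (Site 2) × Set (Site 2)) =>
        (x.1 ∩ P₂, (x.2.1 ∩ Q₂, x.2.2 ∩ C₂)))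
    (indepFun_inter_of_disjoint half dB) h345
  have h := indepFun_prod_pair (mInter A₁) (mInter A₂)
    (((mInter B₁).comp measurable_fst).prodMk
      ((((mInter P₁).comp measurable_fst).prodMk
        ((((mInter Q₁).comp measurable_fst).prodMk
          ((mInter C₁).comp measurable_snd)).comp measurable_snd)).comp measurable_snd) :
      Measurable fun x : Set ℤ × (Set (Site 2) × (Set (Site 2) × Set (Site 2))) =>
        (x.1 ∩ B₁, (x.2.1 ∩ P₁, (x.2.2.1 ∩ Q₁, x.2.2.2 ∩ C₁))))
    (((mInter B₂).comp measurable_fst).prodMk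
      ((((mInter P₂).comp measurable_fst).prodMk
        ((((mInter Q₂).comp measurable_fst).prodMk
          ((mInter C₂).comp measurable_snd)).comp measurable_snd)).comp measurable_snd) :
      Measurable fun x : Set ℤ × (Set (Site 2) × (Set (Site 2) × Set (Site 2))) =>
        (x.1 ∩ B₂, (x.2.1 ∩ P₂, (x.2.2.1 ∩ Q₂, x.2.2.2 ∩ C₂))))
    (indepFun_inter_of_disjoint half dA) h2345
  unfold μIK
  exact h

/-- AXIS and the sheared (TWISTS off the axis, coins) are independent under `μIK` (disjoint coordinates). -/
theorem indepFun_axis_pairShear (S : Set ℤ) :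
    IndepFun (fun ω : Ω => {x : ℤ | (![x, 0] : Site 2) ∈ blackSet S ω})
      (fun ω : Ω => ({v : Site 2 | v 1 ≠ 0 ∧ Xor (v 1 ∈ ω.2.1)
        (Odd ((Finset.Ico (min 0 (v 0)) (max 0 (v 0)) ×ˢ Finset.Ico (min 0 (v 1)) (max 0 (v 1))).filter
          (fun f : ℤ × ℤ => (![f.1, f.2] : Site 2) ∈ parSet S ω)).card)}, ω.2.2.2.2)) μIK := by
  have dA : Disjoint (Set.univ : Set ℤ) ∅ := disjoint_bot_right
  have dB : Disjoint {y : ℤ | y = 0} {y : ℤ | y ≠ 0} :=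
    Set.disjoint_left.2 fun y (hy : y = 0) (hy' : y ≠ 0) => hy' hy
  have dF : Disjoint (∅ : Set (Site 2)) Set.univ := disjoint_bot_left
  exact ((indepFun_proj dA dB dF dF dF).comp (measurable_axis S)
      ((measurable_twistShear S fun y => y ≠ 0).prodMk measurable_snd.snd.snd.snd)).congr
    (ae_of_all _ fun ω => axis_proj S ∅ ∅ ∅ ω)
    (ae_of_all _ fun ω => Prod.ext
      (twistShear_proj S (fun y => y ≠ 0) Set.univ (fun _ _ _ _ => Set.mem_univ _) Set.univ ∅ ω)
      (Set.inter_univ _))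

/-- AXIS and (TWISTS off the axis, coins), both precomposed with the shear, are independent under `μIK`. -/
theorem indepFun_axis_pair_comp_shear (S : Set ℤ) :
    IndepFun ((fun ω : Ω => {x : ℤ | (![x, 0] : Site 2) ∈ blackSet S ω}) ∘
        (fun ω : Ω => ((ω.1, ({y : ℤ | Xor (y ∈ ω.2.1) ((0 : ℤ) ∈ ω.2.1 ∧ y ≠ 0)}, ω.2.2)) : Ω)))
      ((fun ω : Ω => ({v : Site 2 | v 1 ≠ 0 ∧ Xor (v ∈ blackSet S ω) ((![v 0, 0] : Site 2) ∈ blackSet S ω)},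
          ω.2.2.2.2)) ∘
        (fun ω : Ω => ((ω.1, ({y : ℤ | Xor (y ∈ ω.2.1) ((0 : ℤ) ∈ ω.2.1 ∧ y ≠ 0)}, ω.2.2)) : Ω))) μIK :=
  (indepFun_axis_pairShear S).congr (ae_of_all _ fun ω => (axis_shear S ω).symm)
    (ae_of_all _ fun ω => (pair_shear S ω).symm)

/-- The sheared UPPER and LOWER TWISTS are independent under `μIK` (disjoint coordinates). -/
theorem indepFun_upShear_loShear (S : Set ℤ) :
    IndepFun (fun ω : Ω => {v : Site 2 | 0 < v 1 ∧ Xor (v 1 ∈ ω.2.1)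
        (Odd ((Finset.Ico (min 0 (v 0)) (max 0 (v 0)) ×ˢ Finset.Ico (min 0 (v 1)) (max 0 (v 1))).filter
          (fun f : ℤ × ℤ => (![f.1, f.2] : Site 2) ∈ parSet S ω)).card)})
      (fun ω : Ω => {v : Site 2 | v 1 < 0 ∧ Xor (v 1 ∈ ω.2.1)
        (Odd ((Finset.Ico (min 0 (v 0)) (max 0 (v 0)) ×ˢ Finset.Ico (min 0 (v 1)) (max 0 (v 1))).filter
          (fun f : ℤ × ℤ => (![f.1, f.2] : Site 2) ∈ parSet S ω)).card)}) μIK := by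
  have dA : Disjoint (∅ : Set ℤ) ∅ := disjoint_bot_left
  have dB : Disjoint {y : ℤ | 0 < y} {y : ℤ | y < 0} :=
    Set.disjoint_left.2 fun y (hy : 0 < y) (hy' : y < 0) => by omega
  have dF : Disjoint {g : Site 2 | 0 ≤ g 1} {g : Site 2 | g 1 < 0} :=
    Set.disjoint_left.2 fun g (hg : 0 ≤ g 1) (hg' : g 1 < 0) => by omega
  have dC : Disjoint (∅ : Set (Site 2)) ∅ := disjoint_bot_left
  exact ((indepFun_proj dA dB dF dF dC).comp (measurable_twistShear S fun y => 0 < y)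
      (measurable_twistShear S fun y => y < 0)).congr
    (ae_of_all _ fun ω => twistShear_proj S (fun y => 0 < y) {g : Site 2 | 0 ≤ g 1} faces_upper ∅ ∅ ω)
    (ae_of_all _ fun ω => twistShear_proj S (fun y => y < 0) {g : Site 2 | g 1 < 0} faces_lower ∅ ∅ ω)

/-- UPPER and LOWER TWISTS, both precomposed with the shear, are independent under `μIK`. -/
theorem indepFun_up_lo_comp_shear (S : Set ℤ) :
    IndepFun ((fun ω : Ω => {v : Site 2 | 0 < v 1 ∧ Xor (v ∈ blackSet S ω) ((![v 0, 0] : Site 2) ∈ blackSet S ω)}) ∘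
        (fun ω : Ω => ((ω.1, ({y : ℤ | Xor (y ∈ ω.2.1) ((0 : ℤ) ∈ ω.2.1 ∧ y ≠ 0)}, ω.2.2)) : Ω)))
      ((fun ω : Ω => {v : Site 2 | v 1 < 0 ∧ Xor (v ∈ blackSet S ω) ((![v 0, 0] : Site 2) ∈ blackSet S ω)}) ∘
        (fun ω : Ω => ((ω.1, ({y : ℤ | Xor (y ∈ ω.2.1) ((0 : ℤ) ∈ ω.2.1 ∧ y ≠ 0)}, ω.2.2)) : Ω))) μIK :=
  (indepFun_upShear_loShear S).congr
    (ae_of_all _ fun ω => (twist_shear S (fun y => 0 < y) (lt_irrefl 0) ω).symm)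
    (ae_of_all _ fun ω => (twist_shear S (fun y => y < 0) (lt_irrefl 0) ω).symm)

end RowTwistStub

open RowTwistStub in
/-- **Registered helper `indepFun_row_twist`** (ROW TWIST, memo (†) of the line `defect-closure-exploration`):
for every column pattern `S`, under the gauge law `μIK` the axis row colours are independent of (the colour
twists of all other rows relative to the axis, the coins), and the upper twists are independent of the lower
twists. -/
theorem indepFun_row_twist : ∀ S : Set ℤ, ProbabilityTheory.IndepFun
    (fun ω : Ω => {x : ℤ | (![x, 0] : Site 2) ∈ blackSet S ω})
    (fun ω : Ω => ({v : Site 2 | v 1 ≠ 0 ∧ Xor (v ∈ blackSet S ω) ((![v 0, 0] : Site 2) ∈ blackSet S ω)},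
      ω.2.2.2.2)) μIK ∧
    ProbabilityTheory.IndepFun
      (fun ω : Ω => {v : Site 2 | 0 < v 1 ∧ Xor (v ∈ blackSet S ω) ((![v 0, 0] : Site 2) ∈ blackSet S ω)})
      (fun ω : Ω => {v : Site 2 | v 1 < 0 ∧ Xor (v ∈ blackSet S ω) ((![v 0, 0] : Site 2) ∈ blackSet S ω)})
      μIK := by
  intro S
  have h₁ := indepFun_map_of_comp measurePreserving_shearΩ.measurable (measurable_axis S) (measurable_pair S)
    (indepFun_axis_pair_comp_shear S)
  have h₂ := indepFun_map_of_comp measurePreserving_shearΩ.measurable (measurable_twist S fun y => 0 < y)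
    (measurable_twist S fun y => y < 0) (indepFun_up_lo_comp_shear S)
  rw [measurePreserving_shearΩ.map_eq] at h₁ h₂
  exact ⟨h₁, h₂⟩

end Summit.CriticalPhenomena.CardyFormulaZ2.Cruxes.IKMixedBoxCrossing.DefectClosureExploration

end
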